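import Summits.CriticalPhenomena.SAWScalingLimit.Theses.SAWTotalPositivity
import Summits.CriticalPhenomena.SAWScalingLimit.Theorems.SAWTotalPositivityBoundaryTP2Defs
import Summits.CriticalPhenomena.SAWScalingLimit.Theorems.SAWTotalPositivityBoundaryTP2Kernel
import Summits.CriticalPhenomena.SAWScalingLimit.Theorems.SAWTotalPositivityBoundaryTP2Symmetry
import Summits.CriticalPhenomena.SAWScalingLimit.Theorems.SAWTotalPositivityBoundaryTP2FirstStep
import Summits.CriticalPhenomena.SAWScalingLimit.Theorems.SAWTotalPositivityBoundaryTP2Avoid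
import Summits.CriticalPhenomena.SAWScalingLimit.Theorems.SAWTotalPositivityBoundaryTP2SquareGadget
import Literature.Probability.RandomPlanarGeometry.SelfAvoidingWalkProofs
import HarnessLib

/-!
# Crux `BoundaryTP2` (stmt-CriticalPhenomena-7115), line `Sketch`: the boundary bubble bound is inside
the typed crux

Tool stub `stub_boundaryBubble` of the line's skeleton. The crux
`Summit.CriticalPhenomena.SAWScalingLimit.Theses.SAWTotalPositivity.BoundaryTP2` AS TYPED forces the
critical two-point function of every FLAT boundary edge of every induced lattice domain to be at most `1`:
for a finite lattice-connected site set `S`, its induced graph `H = ℤ²[S]`, an edge `w ∼ w'` of `S` and the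
lattice unit square `w u u' w'` on its outer side, with `u, u' ∉ S` seeing no site of `S` other than `w`,
`w'` respectively,

  `Z_H^{x_c}(w, w') ≤ 1`      (`stub_boundaryBubble`).

Proof. Hang the square on `H`: the gadget graph `G = H ⊔ wu ⊔ uu' ⊔ u'w'` is exactly the induced graph
`ℤ²[S ∪ {u, u'}]` (flatness of the edge), and `S ∪ {u, u'}` is again finite and lattice-connected, so the
landed converse `tp2_induced_of_boundaryTP2` (`…BoundaryTP2Kernel`) yields the crux's TP₂ inequality for
the quadruple `(u, w, w', u')` of `G`, which is interlaced (the last step of a path into `u'` comes from `u`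
or from `w'`) with both nested pairings realised by single edges. The four gadget kernels are evaluated by
first-step decompositions exactly as in the square gadget `pathKernel_le_one_of_graphTP2At`
(`…BoundaryTP2SquareGadget`, whose argument is repeated here with the core `GraphTP2At x` replaced by the
single inequality it was used for): with `z = Z_H(w,w')` and `x = x_c`,
`Z_G(u,w) = Z_G(u',w') = x (1 + x z)` and `Z_G(u,w') = Z_G(u',w) = x (x + z)`, so TP₂ reads
`(x + z)² ≤ (1 + x z)²`, i.e. `(1 - x)(z - 1) ≤ 0`, i.e. `z ≤ 1` because `0 < x_c < 1`
(`SAW.criticalFugacity_pos_lt_one'`). Hence the boundary part of the route's crux `CriticalBubbleBound`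
(a uniform bound on `Z_Ω(u,v)` for lattice-adjacent `u, v`) is already contained in `BoundaryTP2`.
[folklore]
-/

noncomputable section

namespace Summit.CriticalPhenomena.SAWScalingLimit.Theorems.BoundaryTP2

open Literature.Probability.LatticeModels Literature.Probability.RandomPlanarGeometry
open scoped ENNReal

/-! ## Two small generic facts -/

/-- Lattice walks inside a site set are walks inside any larger site set. [folklore] -/
private theorem reflTransGen_siteStep_of_subset {T T' : Set (Site 2)} (hT : T ⊆ T') {a b : Site 2}
    (h : Relation.ReflTransGen (SiteStep T) a b) : Relation.ReflTransGen (SiteStep T') a b := by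
  induction h with
  | refl => exact Relation.ReflTransGen.refl
  | tail _ hs ih => exact ih.tail ⟨hs.1, hT hs.2.1, hT hs.2.2⟩

/-- Adjacency of the gadget graph: `B` with the three edges `w u`, `u u'`, `u' w'` hung on it. [folklore] -/
private theorem bubble_gadget_adj (B : SimpleGraph (Site 2)) (w w' u u' a b : Site 2) :
    (B ⊔ SimpleGraph.edge w u ⊔ SimpleGraph.edge u u' ⊔ SimpleGraph.edge u' w').Adj a b ↔
      B.Adj a b ∨ ((a = w ∧ b = u ∨ a = u ∧ b = w) ∧ a ≠ b) ∨
        ((a = u ∧ b = u' ∨ a = u' ∧ b = u) ∧ a ≠ b) ∨ ((a = u' ∧ b = w' ∨ a = w' ∧ b = u') ∧ a ≠ b) := by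
  simp only [SimpleGraph.sup_adj, SimpleGraph.edge_adj, or_assoc]

/-! ## The square gadget, with the core replaced by the one inequality it is used for -/

/-- **The square gadget, abstract form.** Let `0 < x < 1`, let `B` have finitely many non-isolated
vertices, let `w w'` be an edge of `B`, let `u ≠ u'` be isolated in `B` with `w ≠ u`, `u' ≠ w'`, and let `G`
be `B` with the three edges `w u`, `u u'`, `u' w'` hung on it (given through its adjacency). If the TP₂
inequality `Z_G(u,w') Z_G(w,u') ≤ Z_G(u,w) Z_G(w',u')` holds whenever the quadruple `(u, w, w', u')` of `G`
is interlaced with both nested pairings disjointly realisable, then `Z_B(w,w') ≤ 1`: the quadruple IS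
interlaced and realisable, and by first-step decompositions at the degree-two vertices `u`, `u'` the four
kernels are `x (1 + x z)`, `x (x + z)`, `x (x z + 1)`, `x (x + z)` with `z = Z_B(w,w')`, so the inequality
reads `(x + z)² ≤ (1 + x z)²`. (The argument of `pathKernel_le_one_of_graphTP2At`.) [folklore] -/
private theorem pathKernel_le_one_of_gadget {x : ℝ} (hx0 : 0 < x) (hx1 : x < 1)
    {B G : SimpleGraph (Site 2)} (hfin : B.support.Finite) {w w' u u' : Site 2} (hww' : B.Adj w w')
    (hwu_ne : w ≠ u) (huu'_ne : u ≠ u') (hu'w'_ne : u' ≠ w')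
    (hu : u ∉ B.support) (hu' : u' ∉ B.support)
    (hGadj : ∀ a b, G.Adj a b ↔ B.Adj a b ∨ ((a = w ∧ b = u ∨ a = u ∧ b = w) ∧ a ≠ b) ∨
      ((a = u ∧ b = u' ∨ a = u' ∧ b = u) ∧ a ≠ b) ∨ ((a = u' ∧ b = w' ∨ a = w' ∧ b = u') ∧ a ≠ b))
    (hkey : Interlaced G u w w' u' → DisjointPaths G u w w' u' → DisjointPaths G u u' w w' →
      pathKernel G x u w' * pathKernel G x w u' ≤ pathKernel G x u w * pathKernel G x w' u') :
    pathKernel B x w w' ≤ 1 := by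
  classical
  -- distinctness
  have hne : ∀ {a b : Site 2}, a ∈ B.support → b ∉ B.support → a ≠ b :=
    fun ha hb hab => hb (hab ▸ ha)
  have hww'_ne : w ≠ w' := hww'.ne
  have hwu'_ne : w ≠ u' := hne ⟨w', hww'⟩ hu'
  have hw'u_ne : w' ≠ u := hne ⟨w, hww'.symm⟩ hu
  -- no `B`-edges at `u`, `u'`
  have hBu : ∀ z, ¬ B.Adj u z := fun z hz => hu ⟨z, hz⟩
  have hBu' : ∀ z, ¬ B.Adj u' z := fun z hz => hu' ⟨z, hz⟩
  have hle : B ≤ G := fun a b hab => (hGadj a b).2 (Or.inl hab)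
  -- adjacency facts in `G`
  have hGwu : G.Adj w u := (hGadj w u).2 (Or.inr (Or.inl ⟨Or.inl ⟨rfl, rfl⟩, hwu_ne⟩))
  have hGuu' : G.Adj u u' := (hGadj u u').2 (Or.inr (Or.inr (Or.inl ⟨Or.inl ⟨rfl, rfl⟩, huu'_ne⟩)))
  have hGu'w' : G.Adj u' w' :=
    (hGadj u' w').2 (Or.inr (Or.inr (Or.inr ⟨Or.inl ⟨rfl, rfl⟩, hu'w'_ne⟩)))
  have hGww' : G.Adj w w' := hle hww'
  -- neighbourhoods of `u` and `u'` in `G`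
  have hN1 : ∀ z, G.Adj u z ↔ z = w ∨ z = u' := by
    intro z
    constructor
    · intro hz
      rcases (hGadj u z).1 hz with hz | ⟨h', -⟩ | ⟨h', -⟩ | ⟨h', -⟩
      · exact (hBu z hz).elim
      · rcases h' with ⟨h1, -⟩ | ⟨-, h2⟩
        · exact absurd h1.symm hwu_ne
        · exact Or.inl h2
      · rcases h' with ⟨-, h2⟩ | ⟨h1, -⟩
        · exact Or.inr h2
        · exact absurd h1 huu'_ne
      · rcases h' with ⟨h1, -⟩ | ⟨h1, -⟩
        · exact absurd h1 huu'_ne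
        · exact absurd h1.symm hw'u_ne
    · rintro (rfl | rfl)
      · exact hGwu.symm
      · exact hGuu'
  have hN2 : ∀ z, G.Adj u' z ↔ z = u ∨ z = w' := by
    intro z
    constructor
    · intro hz
      rcases (hGadj u' z).1 hz with hz | ⟨h', -⟩ | ⟨h', -⟩ | ⟨h', -⟩
      · exact (hBu' z hz).elim
      · rcases h' with ⟨h1, -⟩ | ⟨h1, -⟩
        · exact absurd h1.symm hwu'_ne
        · exact absurd h1.symm huu'_ne
      · rcases h' with ⟨h1, -⟩ | ⟨-, h2⟩
        · exact absurd h1.symm huu'_ne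
        · exact Or.inl h2
      · rcases h' with ⟨-, h2⟩ | ⟨h1, -⟩
        · exact Or.inr h2
        · exact absurd h1 hu'w'_ne
    · rintro (rfl | rfl)
      · exact hGuu'.symm
      · exact hGu'w'
  -- the vertex-deleted graphs `G - u`, `G - u'`
  set Gu := G.deleteEdges (G.incidenceSet u)
  set Gu' := G.deleteEdges (G.incidenceSet u')
  have hGu_adj : ∀ a b, Gu.Adj a b ↔ G.Adj a b ∧ a ≠ u ∧ b ≠ u := deleteEdges_incidenceSet_adj G u
  have hGu'_adj : ∀ a b, Gu'.Adj a b ↔ G.Adj a b ∧ a ≠ u' ∧ b ≠ u' :=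
    deleteEdges_incidenceSet_adj G u'
  -- `(G - u) - u' = B = (G - u') - u`
  have hGB : ∀ a b, G.Adj a b → a ≠ u → b ≠ u → a ≠ u' → b ≠ u' → B.Adj a b := by
    intro a b hab hau hbu hau' hbu'
    rcases (hGadj a b).1 hab with h' | ⟨h', -⟩ | ⟨h', -⟩ | ⟨h', -⟩
    · exact h'
    · rcases h' with ⟨-, h2⟩ | ⟨h1, -⟩
      · exact absurd h2 hbu
      · exact absurd h1 hau
    · rcases h' with ⟨h1, -⟩ | ⟨h1, -⟩
      · exact absurd h1 hau
      · exact absurd h1 hau'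
    · rcases h' with ⟨h1, -⟩ | ⟨-, h2⟩
      · exact absurd h1 hau'
      · exact absurd h2 hbu'
  have hBG : ∀ a b, B.Adj a b → G.Adj a b ∧ a ≠ u ∧ b ≠ u ∧ a ≠ u' ∧ b ≠ u' := fun a b hab =>
    ⟨hle hab, hne ⟨b, hab⟩ hu, hne ⟨a, hab.symm⟩ hu, hne ⟨b, hab⟩ hu', hne ⟨a, hab.symm⟩ hu'⟩
  have hB1 : Gu.deleteEdges (Gu.incidenceSet u') = B := by
    ext a b
    rw [deleteEdges_incidenceSet_adj, hGu_adj]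
    constructor
    · rintro ⟨⟨hab, hau, hbu⟩, hau', hbu'⟩
      exact hGB a b hab hau hbu hau' hbu'
    · intro hab
      obtain ⟨h1, h2, h3, h4, h5⟩ := hBG a b hab
      exact ⟨⟨h1, h2, h3⟩, h4, h5⟩
  have hB2 : Gu'.deleteEdges (Gu'.incidenceSet u) = B := by
    ext a b
    rw [deleteEdges_incidenceSet_adj, hGu'_adj]
    constructor
    · rintro ⟨⟨hab, hau', hbu'⟩, hau, hbu⟩
      exact hGB a b hab hau hbu hau' hbu'
    · intro hab
      obtain ⟨h1, h2, h3, h4, h5⟩ := hBG a b hab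
      exact ⟨⟨h1, h4, h5⟩, h2, h3⟩
  -- neighbour sets
  have hN_u : G.neighborSet u = {w, u'} := by
    ext z
    rw [SimpleGraph.mem_neighborSet, hN1 z, Set.mem_insert_iff, Set.mem_singleton_iff]
  have hN_u' : G.neighborSet u' = {u, w'} := by
    ext z
    rw [SimpleGraph.mem_neighborSet, hN2 z, Set.mem_insert_iff, Set.mem_singleton_iff]
  have hN_u'_Gu : Gu.neighborSet u' = {w'} := by
    ext z
    rw [SimpleGraph.mem_neighborSet, hGu_adj, hN2 z, Set.mem_singleton_iff]
    constructor
    · rintro ⟨hz | hz, -, hzu⟩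
      · exact absurd hz hzu
      · exact hz
    · rintro rfl
      exact ⟨Or.inr rfl, huu'_ne.symm, hw'u_ne⟩
  have hN_u_Gu' : Gu'.neighborSet u = {w} := by
    ext z
    rw [SimpleGraph.mem_neighborSet, hGu'_adj, hN1 z, Set.mem_singleton_iff]
    constructor
    · rintro ⟨hz | hz, -, hzu'⟩
      · exact hz
      · exact absurd hz hzu'
    · rintro rfl
      exact ⟨Or.inl rfl, huu'_ne, hwu'_ne⟩
  -- leaves: in `G - u` the only neighbour of `u'` is `w'`; in `G - u'` the only neighbour of `u` is `w`
  have hleaf_u' : ∀ z, Gu.Adj u' z → z = w' := fun z hz => by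
    have hz' : z ∈ Gu.neighborSet u' := hz
    rwa [hN_u'_Gu, Set.mem_singleton_iff] at hz'
  have hleaf_u : ∀ z, Gu'.Adj u z → z = w := fun z hz => by
    have hz' : z ∈ Gu'.neighborSet u := hz
    rwa [hN_u_Gu', Set.mem_singleton_iff] at hz'
  -- the four gadget kernels in terms of `z = Z_B(w,w')`
  have hxle : 0 ≤ x := hx0.le
  set z := pathKernel B x w w'
  have K1 : pathKernel G x u w = ENNReal.ofReal x * (1 + ENNReal.ofReal x * z) := by
    rw [pathKernel_firstStep_pair G x hxle hwu_ne.symm hwu'_ne hN_u, pathKernel_self,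
      pathKernel_firstStep_single Gu x hxle hwu'_ne.symm hN_u'_Gu, hB1, pathKernel_comm B x w' w]
  have K2 : pathKernel G x u w' = ENNReal.ofReal x * (z + ENNReal.ofReal x) := by
    rw [pathKernel_firstStep_pair G x hxle hw'u_ne.symm hwu'_ne hN_u,
      pathKernel_eq_deleteVert_of_leaf Gu x hleaf_u' hwu'_ne hu'w'_ne.symm, hB1,
      pathKernel_firstStep_single Gu x hxle hu'w'_ne hN_u'_Gu, hB1, pathKernel_self, mul_one]
  have K3 : pathKernel G x u' w' = ENNReal.ofReal x * (ENNReal.ofReal x * z + 1) := by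
    rw [pathKernel_firstStep_pair G x hxle hu'w'_ne hw'u_ne.symm hN_u',
      pathKernel_firstStep_single Gu' x hxle hw'u_ne.symm hN_u_Gu', hB2, pathKernel_self]
  have K4 : pathKernel G x u' w = ENNReal.ofReal x * (ENNReal.ofReal x + z) := by
    rw [pathKernel_firstStep_pair G x hxle hwu'_ne.symm hw'u_ne.symm hN_u',
      pathKernel_firstStep_single Gu' x hxle hwu_ne.symm hN_u_Gu', hB2, pathKernel_self, mul_one,
      pathKernel_eq_deleteVert_of_leaf Gu' x hleaf_u hw'u_ne hwu_ne, hB2, pathKernel_comm B x w' w]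
  -- hypotheses (i)–(iii) for the quadruple `(u, w, w', u')` of `G`
  have hI : Interlaced G u w w' u' := by
    intro P Q
    obtain ⟨v, hadj, q, hq⟩ := SimpleGraph.Walk.exists_eq_cons_of_ne hwu'_ne.symm Q.1.reverse
    have hvQ : v ∈ Q.1.support := by
      have hmem : v ∈ Q.1.reverse.support := by
        rw [hq, SimpleGraph.Walk.support_cons]
        exact List.mem_cons_of_mem _ q.start_mem_support
      rwa [SimpleGraph.Walk.support_reverse, List.mem_reverse] at hmem
    rcases (hN2 v).1 hadj with rfl | rfl
    · exact ⟨_, P.1.start_mem_support, hvQ⟩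
    · exact ⟨_, P.1.end_mem_support, hvQ⟩
  have hD1 : DisjointPaths G u w w' u' := by
    refine ⟨SimpleGraph.Path.singleton hGwu.symm, SimpleGraph.Path.singleton hGu'w'.symm, ?_⟩
    simp only [SimpleGraph.Path.singleton_coe, SimpleGraph.Walk.support_cons,
      SimpleGraph.Walk.support_nil]
    intro a ha hb
    simp only [List.mem_cons, List.not_mem_nil, or_false] at ha hb
    rcases ha with rfl | rfl <;> rcases hb with h | h
    exacts [hw'u_ne h.symm, huu'_ne h, hww'_ne h, hwu'_ne h]
  have hD2 : DisjointPaths G u u' w w' := by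
    refine ⟨SimpleGraph.Path.singleton hGuu', SimpleGraph.Path.singleton hGww', ?_⟩
    simp only [SimpleGraph.Path.singleton_coe, SimpleGraph.Walk.support_cons,
      SimpleGraph.Walk.support_nil]
    intro a ha hb
    simp only [List.mem_cons, List.not_mem_nil, or_false] at ha hb
    rcases ha with rfl | rfl <;> rcases hb with h | h
    exacts [hwu_ne h.symm, hw'u_ne h.symm, hwu'_ne h.symm, hu'w'_ne h]
  -- apply the inequality and evaluate
  have key := hkey hI hD1 hD2
  rw [pathKernel_comm G x w u', pathKernel_comm G x w' u', K1, K2, K3, K4] at key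
  have hz_top : z ≠ ⊤ := pathKernel_ne_top hfin x w w'
  have hzζ : z = ENNReal.ofReal z.toReal := (ENNReal.ofReal_toReal hz_top).symm
  set ζ := z.toReal
  have hζ0 : 0 ≤ ζ := ENNReal.toReal_nonneg
  rw [hzζ] at key ⊢
  have e1 : ENNReal.ofReal x * (ENNReal.ofReal ζ + ENNReal.ofReal x) =
      ENNReal.ofReal (x * (ζ + x)) := by rw [← ENNReal.ofReal_add hζ0 hxle, ← ENNReal.ofReal_mul hxle]
  have e2 : ENNReal.ofReal x * (ENNReal.ofReal x + ENNReal.ofReal ζ) =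
      ENNReal.ofReal (x * (x + ζ)) := by rw [← ENNReal.ofReal_add hxle hζ0, ← ENNReal.ofReal_mul hxle]
  have e3 : ENNReal.ofReal x * (1 + ENNReal.ofReal x * ENNReal.ofReal ζ) =
      ENNReal.ofReal (x * (1 + x * ζ)) := by
    rw [← ENNReal.ofReal_mul hxle, ← ENNReal.ofReal_one, ← ENNReal.ofReal_add zero_le_one
      (mul_nonneg hxle hζ0), ← ENNReal.ofReal_mul hxle]
  have e4 : ENNReal.ofReal x * (ENNReal.ofReal x * ENNReal.ofReal ζ + 1) =
      ENNReal.ofReal (x * (x * ζ + 1)) := by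
    rw [← ENNReal.ofReal_mul hxle, ← ENNReal.ofReal_one, ← ENNReal.ofReal_add
      (mul_nonneg hxle hζ0) zero_le_one, ← ENNReal.ofReal_mul hxle]
  rw [e1, e2, e3, e4, ← ENNReal.ofReal_mul (mul_nonneg hxle (add_nonneg hζ0 hxle)),
    ← ENNReal.ofReal_mul (mul_nonneg hxle (add_nonneg zero_le_one (mul_nonneg hxle hζ0))),
    ENNReal.ofReal_le_ofReal_iff (by positivity)] at key
  -- `key : x (ζ + x) · x (x + ζ) ≤ x (1 + x ζ) · x (x ζ + 1)` over `ℝ`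
  have eqL : x * (ζ + x) * (x * (x + ζ)) = x ^ 2 * (ζ + x) ^ 2 := by ring
  have eqR : x * (1 + x * ζ) * (x * (x * ζ + 1)) = x ^ 2 * (1 + x * ζ) ^ 2 := by ring
  rw [eqL, eqR] at key
  have h3 : (ζ + x) ^ 2 ≤ (1 + x * ζ) ^ 2 := le_of_mul_le_mul_left key (by positivity)
  have h4 : ζ + x ≤ 1 + x * ζ :=
    (pow_le_pow_iff_left₀ (by positivity) (by positivity) two_ne_zero).1 h3
  have h5 : ζ ≤ 1 := by nlinarith [h4, hx0, hx1]
  calc ENNReal.ofReal ζ ≤ ENNReal.ofReal 1 := ENNReal.ofReal_le_ofReal h5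
    _ = 1 := ENNReal.ofReal_one

/-! ## The stub -/

/-- **The boundary bubble bound from the typed crux.** `BoundaryTP2` as typed forces the critical
boundary two-point function of adjacent sites to be at most `1` on every FLAT boundary edge: for a finite
lattice-connected site set `S`, its induced graph `H = ℤ²[S]`, an edge `w ∼ w'` of `S` and the lattice unit
square `w u u' w'` on its outer side with `u, u' ∉ S` seeing no site of `S` other than `w`, `w'`
respectively, `Z_H^{x_c}(w,w') ≤ 1`. Hang the square: `S ∪ {u,u'}` is again a finite lattice-connected
site set whose induced graph is the gadget graph `H ⊔ wu ⊔ uu' ⊔ u'w'`; apply the landed converse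
`tp2_induced_of_boundaryTP2` to the interlaced quadruple `(u,w,w',u')` and evaluate the four gadget
kernels by first-step decompositions (`pathKernel_le_one_of_gadget`, the argument of
`pathKernel_le_one_of_graphTP2At`); conclude with `0 < x_c < 1`. [folklore] -/
theorem stub_boundaryBubble
    (hTP : Summit.CriticalPhenomena.SAWScalingLimit.Theses.SAWTotalPositivity.BoundaryTP2)
    {S : Set (Site 2)} (hS : S.Finite)
    (hconn : ∀ x ∈ S, ∀ y ∈ S, Relation.ReflTransGen (SiteStep S) x y)
    {H : SimpleGraph (Site 2)} (hH : ∀ x y, H.Adj x y ↔ (zdGraph 2).Adj x y ∧ x ∈ S ∧ y ∈ S)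
    {w w' u u' : Site 2} (hw : w ∈ S) (hw' : w' ∈ S) (hww' : (zdGraph 2).Adj w w')
    (hwu : (zdGraph 2).Adj w u) (huu' : (zdGraph 2).Adj u u') (hu'w' : (zdGraph 2).Adj u' w')
    (hu : u ∉ S) (hu' : u' ∉ S) (hNu : ∀ z ∈ S, (zdGraph 2).Adj u z → z = w)
    (hNu' : ∀ z ∈ S, (zdGraph 2).Adj u' z → z = w') :
    pathKernel H SAW.criticalFugacity w w' ≤ 1 := by
  classical
  obtain ⟨hx0, hx1⟩ := SAW.criticalFugacity_pos_lt_one'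
  -- `H`-edges stay inside `S`; `u`, `u'` are isolated in `H`
  have hsupp : H.support ⊆ S := by
    rintro a ⟨b, hab⟩
    exact ((hH a b).1 hab).2.1
  have hfin : H.support.Finite := hS.subset hsupp
  have huH : u ∉ H.support := fun h => hu (hsupp h)
  have hu'H : u' ∉ H.support := fun h => hu' (hsupp h)
  have hHww' : H.Adj w w' := (hH w w').2 ⟨hww', hw, hw'⟩
  -- the gadget graph `G` and the enlarged site set `S' = S ∪ {u, u'}`
  obtain ⟨G, hG⟩ : ∃ G : SimpleGraph (Site 2),
      G = H ⊔ SimpleGraph.edge w u ⊔ SimpleGraph.edge u u' ⊔ SimpleGraph.edge u' w' := ⟨_, rfl⟩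
  have hGadj : ∀ a b, G.Adj a b ↔ H.Adj a b ∨ ((a = w ∧ b = u ∨ a = u ∧ b = w) ∧ a ≠ b) ∨
      ((a = u ∧ b = u' ∨ a = u' ∧ b = u) ∧ a ≠ b) ∨ ((a = u' ∧ b = w' ∨ a = w' ∧ b = u') ∧ a ≠ b) := by
    intro a b; rw [hG]; exact bubble_gadget_adj H w w' u u' a b
  obtain ⟨S', hS'⟩ : ∃ S' : Set (Site 2), S' = insert u (insert u' S) := ⟨_, rfl⟩
  have hmem : ∀ a, a ∈ S' ↔ a = u ∨ a = u' ∨ a ∈ S := by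
    intro a; rw [hS', Set.mem_insert_iff, Set.mem_insert_iff]
  have hS'fin : S'.Finite := by rw [hS']; exact (hS.insert u').insert u
  have hSS' : S ⊆ S' := fun a ha => (hmem a).2 (Or.inr (Or.inr ha))
  -- `G = ℤ²[S']` (flatness of the boundary edge)
  have hGS' : ∀ a b, G.Adj a b ↔ (zdGraph 2).Adj a b ∧ a ∈ S' ∧ b ∈ S' := by
    intro a b
    rw [hGadj, hmem a, hmem b]
    constructor
    · rintro (hab | ⟨h', -⟩ | ⟨h', -⟩ | ⟨h', -⟩)
      · obtain ⟨hzd, ha, hb⟩ := (hH a b).1 hab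
        exact ⟨hzd, Or.inr (Or.inr ha), Or.inr (Or.inr hb)⟩
      · rcases h' with ⟨rfl, rfl⟩ | ⟨rfl, rfl⟩
        · exact ⟨hwu, Or.inr (Or.inr hw), Or.inl rfl⟩
        · exact ⟨hwu.symm, Or.inl rfl, Or.inr (Or.inr hw)⟩
      · rcases h' with ⟨rfl, rfl⟩ | ⟨rfl, rfl⟩
        · exact ⟨huu', Or.inl rfl, Or.inr (Or.inl rfl)⟩
        · exact ⟨huu'.symm, Or.inr (Or.inl rfl), Or.inl rfl⟩
      · rcases h' with ⟨rfl, rfl⟩ | ⟨rfl, rfl⟩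
        · exact ⟨hu'w', Or.inr (Or.inl rfl), Or.inr (Or.inr hw')⟩
        · exact ⟨hu'w'.symm, Or.inr (Or.inr hw'), Or.inr (Or.inl rfl)⟩
    · rintro ⟨hzd, ha | ha | ha, hb | hb | hb⟩
      · subst ha; subst hb
        exact (hzd.ne rfl).elim
      · subst ha; subst hb
        exact Or.inr (Or.inr (Or.inl ⟨Or.inl ⟨rfl, rfl⟩, hzd.ne⟩))
      · subst ha
        obtain rfl := hNu b hb hzd
        exact Or.inr (Or.inl ⟨Or.inr ⟨rfl, rfl⟩, hzd.ne⟩)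
      · subst ha; subst hb
        exact Or.inr (Or.inr (Or.inl ⟨Or.inr ⟨rfl, rfl⟩, hzd.ne⟩))
      · subst ha; subst hb
        exact (hzd.ne rfl).elim
      · subst ha
        obtain rfl := hNu' b hb hzd
        exact Or.inr (Or.inr (Or.inr ⟨Or.inl ⟨rfl, rfl⟩, hzd.ne⟩))
      · subst hb
        obtain rfl := hNu a ha hzd.symm
        exact Or.inr (Or.inl ⟨Or.inl ⟨rfl, rfl⟩, hzd.ne⟩)
      · subst hb
        obtain rfl := hNu' a ha hzd.symm
        exact Or.inr (Or.inr (Or.inr ⟨Or.inr ⟨rfl, rfl⟩, hzd.ne⟩))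
      · exact Or.inl ((hH a b).2 ⟨hzd, ha, hb⟩)
  -- `S'` is lattice-connected: through `w`
  have hto : ∀ a ∈ S', Relation.ReflTransGen (SiteStep S') a w := by
    intro a ha
    rcases (hmem a).1 ha with rfl | rfl | haS
    · exact Relation.ReflTransGen.single ⟨hwu.symm, ha, hSS' hw⟩
    · exact (Relation.ReflTransGen.single ⟨hu'w', ha, hSS' hw'⟩).trans
        (reflTransGen_siteStep_of_subset hSS' (hconn w' hw' w hw))
    · exact reflTransGen_siteStep_of_subset hSS' (hconn a haS w hw)
  have hfrom : ∀ b ∈ S', Relation.ReflTransGen (SiteStep S') w b := by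
    intro b hb
    rcases (hmem b).1 hb with rfl | rfl | hbS
    · exact Relation.ReflTransGen.single ⟨hwu, hSS' hw, hb⟩
    · exact (reflTransGen_siteStep_of_subset hSS' (hconn w hw w' hw')).tail ⟨hu'w'.symm, hSS' hw', hb⟩
    · exact reflTransGen_siteStep_of_subset hSS' (hconn w hw b hbS)
  have hconn' : ∀ a ∈ S', ∀ b ∈ S', Relation.ReflTransGen (SiteStep S') a b :=
    fun a ha b hb => (hto a ha).trans (hfrom b hb)
  -- the crux, through the landed converse, on the gadget quadruple `(u, w, w', u')` of `G = ℤ²[S']`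
  refine pathKernel_le_one_of_gadget hx0 hx1 hfin hHww' hwu.ne huu'.ne hu'w'.ne huH hu'H hGadj ?_
  intro hI hD₁ hD₂
  exact tp2_induced_of_boundaryTP2 hTP hS'fin hconn' hGS' hI hD₁ hD₂

end Summit.CriticalPhenomena.SAWScalingLimit.Theorems.BoundaryTP2
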